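import Summits.BirchSwinnertonDyer.Rank1Residual.ManinAdditive.DegeneracyClassUnitTwist
import Summits.BirchSwinnertonDyer.Rank1Residual.ManinAdditive.NineShiftEqualiserLaw
import Mathlib.NumberTheory.LSeries.PrimesInAP
import HarnessLib
import HarnessLib.Audit.Tags

/-!
# The ORBIT CRITERION for the prime-class degeneracy law (K_t)♮: conjugation defects, THEOREM O / O′ (PROVED) —
# typed (es g22/g23, MEMO-es §36–§37; cell `bsd-f2-manin`, T-es-30 file 2/2, part A, typer g15)

HONEST FRAMING.  LENS = Eisenstein-series / Γ₀-side (`bsd-f2-manin-es` g22/g23).  SOURCE = HOME/es/Sketch-es-g23-orbit.lean sha16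
5ff425108273d8d9 (528 l., farm rc 0 · 0 sorries · standard axioms, re-checked by the typer), sections `Cocycle`, `Main` and the
`ConjDefectUnit` packaging VERBATIM in namespace `…ManinAdditive.DegeneracyOrbit` (the sketch's `BsdF2ManinEsG22Orbit`); the law sections
((CD₉) `ConjDefectLawNine`, (H₉ mod 3) `ClassLoopSpanLawNineMod3` and their PROVED edges) follow in the sibling `DegeneracyOrbitLaws.lean`
(400-line cap).  Deviations: (i) this header; (ii) DEDUP — the sketch's matrix helpers `slOf`/`g0Of`/`slOf_apply_**`/`slOf_mem_gamma0`
are the (body-identical, `NeZero`-free) ones of `NineShiftEqualiserLaw.lean`, opened here, not re-declared.  EVERYTHING IN THIS FILE IS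
PROVED (no conjecture nodes): it is elementary Manin-relation bookkeeping + Dirichlet's theorem on primes in progressions (Mathlib).

WHAT IS HERE.  The law's loops `{b/m → t·b/m}` are the values `u(r) := {∞, t r} − {∞, r}` of a 1-cochain on cusps; for
`γ = (a b; tc d) ∈ Γ₀(tN)` the COCYCLE IDENTITY `u(γ r) = u(r) + D(γ)` holds with the CONJUGATION DEFECT `conjDefect f t a b c d`
`:= {∞, δ∞} − {∞, γ∞}`, `δ := diag(t,1) γ diag(t,1)⁻¹ = (a tb; c d) ∈ Γ₀(N)` (two Manin relations: `loop_base_eq_conjDefect`,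
`loop_shift_eq_conjDefect`), and `D` vanishes on the parabolics fixing `0` (`cuspSymbol_lowerUnipotent`).  Moving the cusp `γ·0 = b/d` along
the orbit of the lower unipotents `(1 0; tNk 1)` runs its denominator through the progression `d + tNb·k`, which by DIRICHLET contains primes
`≡ 2 (mod 3)` (as `3 ∣ t` forces `3 ∤ d`).  **THEOREM O** `degeneracyClass_of_conjDefect` (PROVED): (K_t)♮ at a rational newform `f` ⟸ some
`γ ∈ Γ₀(tN)` has conjugation defect with plus coordinate prime to 3; **THEOREM O′** `conjDefect_of_degeneracyClass` (PROVED): conversely every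
prime-class loop IS such a defect; hence `degeneracyClass_iff_conjDefectUnit`: for `3 ∣ t ≠ 0`, `DegeneracyClassPlusIndexPrimeTo f 3 t ↔
ConjDefectUnit f t` — the plus-period homomorphism `j_f : Γ₀(N) → ℤ → ℤ/3` is not `diag(t,1)`-conjugation invariant on `Γ₀(tN)`
(`π₁^* j̄_f ≠ π_t^* j̄_f`).  No primes `m`, no characters, no L-values remain in the criterion.
bears_on: stmt-BirchSwinnertonDyer-22968.  PARTITION (es) 0 · beyond-print theorem: no (elementary; new FORMULATION) · BSD is not proved
by this; Manin's conjecture is not proved by this.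
-/

noncomputable section

open scoped Classical MatrixGroups ModularForm ComplexConjugate

open CongruenceSubgroup Complex Literature.NumberTheory.EllipticCurves
  Literature.NumberTheory.EllipticCurves.ModularForms
open Summit.BirchSwinnertonDyer.Rank1Residual.ManinAdditive.KatoCurve
open Summit.BirchSwinnertonDyer.Rank1Residual.ManinAdditive.Gamma1Lattice
open Summit.BirchSwinnertonDyer.Rank1Residual.ManinAdditive.NineShiftEqualiser (slOf g0Of slOf_apply_00 slOf_apply_01
  slOf_apply_10 slOf_apply_11 slOf_mem_gamma0)

namespace Summit.BirchSwinnertonDyer.Rank1Residual.ManinAdditive.DegeneracyOrbit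

variable {N : ℕ} (f : CuspForm (Gamma0 N) 2)

section Cocycle

variable [NeZero N]

/-- MANIN RELATION for explicit entries: `{∞, (a r + b)/(c r + d)} = {∞, γ∞} + {∞, r}`, `γ = (a b; c d) ∈ Γ₀(N)`. -/
theorem manin_slOf (a b c d : ℤ) (h : a * d - b * c = 1) (hc : (N : ℤ) ∣ c) (r : ℚ)
    (hr : (c : ℚ) * r + d ≠ 0) :
    modularSymbol f (((a : ℚ) * r + b) / ((c : ℚ) * r + d)) =
      cuspSymbol f (g0Of a b c d h hc) + modularSymbol f r := by
  have H := modularSymbol_gamma0_smul_holds f (g0Of (M := N) a b c d h hc) r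
  simp only [g0Of] at H ⊢
  exact H (by simpa [slOf] using hr)

/-- A lower unipotent `(1 0; c 1) ∈ Γ₀(N)` fixes the cusp `0`, so its period `{∞, γ∞}` vanishes. -/
theorem cuspSymbol_lowerUnipotent (c : ℤ) (hc : (N : ℤ) ∣ c) :
    cuspSymbol f (g0Of 1 0 c 1 (by ring) hc) = 0 := by
  have H := manin_slOf f 1 0 c 1 (by ring) hc 0 (by simp)
  simpa using H

/-- The CONJUGATION DEFECT `D(γ) := {∞, δ∞} − {∞, γ∞}` of `γ = (a b; tc d) ∈ Γ₀(tN)`, `δ = (a tb; c d) ∈ Γ₀(N)`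
(`δ = diag(t,1) γ diag(t,1)⁻¹`). -/
def conjDefect (t : ℕ) (a b c d : ℤ) (hdet : a * d - b * (t * c) = 1) (hc : (N : ℤ) ∣ c) : ℂ :=
  cuspSymbol f (g0Of a (t * b) c d (by linear_combination hdet) hc)
    - cuspSymbol f (g0Of a b (t * c) d (by linear_combination hdet) (Dvd.dvd.mul_left hc _))

/-- COCYCLE AT THE CUSP `0`: `{∞, t·b/d} − {∞, b/d} = D(γ)` (`γ·0 = b/d`, `δ·0 = tb/d`). -/
theorem loop_base_eq_conjDefect (t : ℕ) (a b c d : ℤ) (hdet : a * d - b * (t * c) = 1)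
    (hc : (N : ℤ) ∣ c) (hd : d ≠ 0) :
    modularSymbol f (((t : ℚ) * b) / d) - modularSymbol f ((b : ℚ) / d) =
      conjDefect f t a b c d hdet hc := by
  have H1 := manin_slOf f a (t * b) c d (by linear_combination hdet) hc 0 (by simpa using hd)
  have H2 := manin_slOf f a b (t * c) d (by linear_combination hdet) (Dvd.dvd.mul_left hc _) 0
    (by simpa using hd)
  simp only [mul_zero, zero_add, Int.cast_mul, Int.cast_natCast] at H1 H2
  unfold conjDefect
  rw [H1, H2]
  ring

/-- COCYCLE ALONG THE UNIPOTENT ORBIT: for every `k` with `d + tNb·k ≠ 0`,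
`{∞, t·b/(d + tNbk)} − {∞, b/(d + tNbk)} = D(γ)` (the lower unipotents `(1 0; tNk 1)`, `(1 0; Nk 1)` fix `0`). -/
theorem loop_shift_eq_conjDefect (t : ℕ) (a b c d : ℤ) (hdet : a * d - b * (t * c) = 1)
    (hc : (N : ℤ) ∣ c) (hd : d ≠ 0) (k : ℤ) (hk : (d : ℚ) + t * N * b * k ≠ 0) :
    modularSymbol f (((t : ℚ) * b) / (d + t * N * b * k)) - modularSymbol f ((b : ℚ) / (d + t * N * b * k)) =
      conjDefect f t a b c d hdet hc := by
  have hdQ : (d : ℚ) ≠ 0 := by exact_mod_cast hd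
  -- lower unipotent (1 0; tNk 1) ∈ Γ₀(N) at r = b/d
  have hτ : (N : ℤ) ∣ (t : ℤ) * N * k := ⟨t * k, by ring⟩
  have hr1 : (((t : ℤ) * N * k : ℤ) : ℚ) * ((b : ℚ) / d) + (1 : ℤ) ≠ 0 := by
    push_cast
    rw [show (t : ℚ) * N * k * (b / d) + 1 = (d + t * N * b * k) / d by field_simp; ring]
    exact div_ne_zero hk hdQ
  have H1 := manin_slOf f 1 0 ((t : ℤ) * N * k) 1 (by ring) hτ ((b : ℚ) / d) hr1
  rw [cuspSymbol_lowerUnipotent, zero_add] at H1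
  -- lower unipotent (1 0; Nk 1) ∈ Γ₀(N) at r = tb/d
  have hτ' : (N : ℤ) ∣ (N : ℤ) * k := ⟨k, by ring⟩
  have hr2 : (((N : ℤ) * k : ℤ) : ℚ) * (((t : ℚ) * b) / d) + (1 : ℤ) ≠ 0 := by
    push_cast
    rw [show (N : ℚ) * k * (t * b / d) + 1 = (d + t * N * b * k) / d by field_simp; ring]
    exact div_ne_zero hk hdQ
  have H2 := manin_slOf f 1 0 ((N : ℤ) * k) 1 (by ring) hτ' (((t : ℚ) * b) / d) hr2
  rw [cuspSymbol_lowerUnipotent, zero_add] at H2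
  have e1 : ((1 : ℤ) * ((b : ℚ) / d) + (0 : ℤ)) / ((((t : ℤ) * N * k : ℤ) : ℚ) * ((b : ℚ) / d) + (1 : ℤ)) =
      (b : ℚ) / (d + t * N * b * k) := by
    push_cast
    field_simp
    ring
  have e2 : ((1 : ℤ) * (((t : ℚ) * b) / d) + (0 : ℤ)) / ((((N : ℤ) * k : ℤ) : ℚ) * (((t : ℚ) * b) / d) + (1 : ℤ)) =
      ((t : ℚ) * b) / (d + t * N * b * k) := by
    push_cast
    field_simp
    ring
  rw [e1] at H1
  rw [e2] at H2
  rw [H1, H2]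
  exact loop_base_eq_conjDefect f t a b c d hdet hc hd

end Cocycle

section Main

variable [NeZero N]

/-- **THEOREM O (ORBIT CRITERION, es g22; PROVED).**  For a rational newform `f` and a ratio `t` with `3 ∣ t`:
if SOME `γ = (a b; tc d) ∈ Γ₀(tN)` has conjugation defect `D(γ) = {∞, δ∞} − {∞, γ∞}` (`δ = (a tb; c d)`) with
plus coordinate prime to `3`, then the prime-class degeneracy loops of ratio `t` have plus index prime to `3`
(`DegeneracyClassPlusIndexPrimeTo f 3 t`, the conclusion of (K_t)♮).  Dirichlet's theorem supplies the prime
`m ≡ 2 (mod 3)` on the unipotent orbit of the cusp `γ·0`. -/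
theorem degeneracyClass_of_conjDefect (hf : IsNewform0 f) (hQ : coeffField f = ⊥) {t : ℕ} (ht0 : t ≠ 0)
    (ht3 : 3 ∣ t) (a b c d : ℤ) (hdet : a * d - b * (t * c) = 1) (hc : (N : ℤ) ∣ c)
    (hunit : ∃ k : ℤ, ¬ 3 ∣ k ∧
      conjDefect f t a b c d hdet hc + conj (conjDefect f t a b c d hdet hc) = (k : ℂ) * (plusPeriod f : ℂ)) :
    DegeneracyClassPlusIndexPrimeTo f 3 t := by
  have hΩpos : 0 < plusPeriod f := IsNewform0.plusPeriod_pos_holds hf hQ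
  have hΩ : plusPeriod f ≠ 0 := hΩpos.ne'
  have hΩC : (plusPeriod f : ℂ) ≠ 0 := by exact_mod_cast hΩ
  obtain ⟨hre, -⟩ := realPeriods_eq_zmultiples_of_plusPeriod_ne_zero f hΩ
  obtain ⟨k, hk3, hk⟩ := hunit
  set D := conjDefect f t a b c d hdet hc with hDdef
  have hNpos : 0 < N := Nat.pos_of_ne_zero (NeZero.ne N)
  have htpos : 0 < t := Nat.pos_of_ne_zero ht0
  obtain ⟨t', ht'⟩ := ht3
  -- `3 ∤ d`, `d ≠ 0`
  have h3d : ¬ (3 : ℤ) ∣ d := by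
    rintro ⟨d', hd'⟩
    have h1 : (3 : ℤ) ∣ 1 := ⟨a * d' - b * (t' * c), by rw [← hdet, hd', ht']; push_cast; ring⟩
    omega
  have hd0 : d ≠ 0 := by rintro rfl; exact h3d (dvd_zero 3)
  -- `b ≠ 0` (else `D = 0`)
  have hb0 : b ≠ 0 := by
    rintro rfl
    have hD0 : D = 0 := by
      rw [hDdef, ← loop_base_eq_conjDefect f t a 0 c d hdet hc hd0]
      simp
    rw [hD0, map_zero, add_zero] at hk
    have hkC : (k : ℂ) = 0 := by
      rcases mul_eq_zero.mp hk.symm with h | h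
      · exact h
      · exact absurd h hΩC
    have hk0 : k = 0 := by exact_mod_cast hkC
    exact hk3 (hk0 ▸ dvd_zero 3)
  -- coprimality of `d` with `t`, `N`, `b`
  have hcop_t : IsCoprime d (t : ℤ) := ⟨a, -(b * c), by linear_combination hdet⟩
  obtain ⟨c₀, hc₀⟩ := id hc
  have hcop_N : IsCoprime d (N : ℤ) := ⟨a, -(b * t * c₀), by rw [hc₀] at hdet; linear_combination hdet⟩
  have hcop_b : IsCoprime d b := ⟨a, -(t * c), by linear_combination hdet⟩
  -- sign bookkeeping: `ε = sign b`, `β = |b|`, `σ d ≡ 2 (mod 3)`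
  set ε : ℤ := Int.sign b with hεdef
  set β : ℤ := (b.natAbs : ℤ) with hβdef
  have hεβ : ε * β = b := Int.sign_mul_natAbs b
  have hε : ε = 1 ∨ ε = -1 := by
    rcases lt_or_gt_of_ne hb0 with h | h
    · exact Or.inr (Int.sign_eq_neg_one_of_neg h)
    · exact Or.inl (Int.sign_eq_one_of_pos h)
  have hεsq : ε * ε = 1 := by rcases hε with h | h <;> rw [h] <;> norm_num
  have hbε : b * ε = β := by rw [← hεβ]; linear_combination β * hεsq
  obtain ⟨σ, hσ, hσd⟩ : ∃ σ : ℤ, (σ = 1 ∨ σ = -1) ∧ (3 : ℤ) ∣ σ * d - 2 := by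
    rcases (by omega : d % 3 = 1 ∨ d % 3 = 2) with h | h
    · exact ⟨-1, Or.inr rfl, by omega⟩
    · exact ⟨1, Or.inl rfl, by omega⟩
  have hσsq : σ * σ = 1 := by rcases hσ with h | h <;> rw [h] <;> norm_num
  have hσ0 : σ ≠ 0 := by rcases hσ with h | h <;> rw [h] <;> norm_num
  -- the modulus `M = t N |b|` and Dirichlet
  set M : ℕ := t * N * b.natAbs with hMdef
  have hM0 : M ≠ 0 := by
    have : b.natAbs ≠ 0 := Int.natAbs_ne_zero.mpr hb0
    positivity
  have hMZ : (M : ℤ) = (t : ℤ) * N * β := by simp only [hMdef, hβdef, Nat.cast_mul]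
  have hcop_β : IsCoprime d β := by
    have h := hcop_b
    rw [← hεβ] at h
    exact h.of_mul_right_right
  have hcop_M : IsCoprime (σ * d) (M : ℤ) := by
    rw [hMZ]
    refine IsCoprime.mul_left ⟨σ, 0, by linear_combination hσsq⟩ ?_
    exact (hcop_t.mul_right hcop_N).mul_right hcop_β
  obtain ⟨p, hpgt, hpP, hpmod⟩ :=
    Nat.forall_exists_prime_gt_and_zmodEq (t * N + b.natAbs + 3) hM0 hcop_M
  have hp0 : (p : ℤ) ≠ 0 := by exact_mod_cast hpP.ne_zero
  have hp0Q : (p : ℚ) ≠ 0 := by exact_mod_cast hpP.ne_zero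
  obtain ⟨q, hq⟩ := hpmod.dvd
  -- `hq : σ * d - p = M * q`
  set kk : ℤ := -(σ * ε * q) with hkkdef
  have hkey : d + (t : ℤ) * N * b * kk = σ * p := by
    have hp' : (p : ℤ) = σ * d - (M : ℤ) * q := by linarith [hq]
    rw [hp', hkkdef, hMZ]
    linear_combination (-d) * hσsq + (-(t : ℤ) * N * σ * q) * hbε
  have hkeyQ : (d : ℚ) + t * N * b * kk = (σ : ℚ) * p := by exact_mod_cast hkey
  have hden : (d : ℚ) + t * N * b * kk ≠ 0 := by
    rw [hkeyQ]; exact mul_ne_zero (by exact_mod_cast hσ0) hp0Q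
  -- the loop on the orbit equals `D`
  have hloop := loop_shift_eq_conjDefect f t a b c d hdet hc hd0 kk hden
  rw [hkeyQ] at hloop
  -- the class of `p`
  have hp3 : p % 3 = 2 := by
    have h3M : (3 : ℤ) ∣ (M : ℤ) := ⟨(t' : ℤ) * N * β, by rw [hMZ, ht']; push_cast; ring⟩
    have h3 : (3 : ℤ) ∣ σ * d - p := by rw [hq]; exact Dvd.dvd.mul_right h3M q
    omega
  have hptN : ¬ p ∣ t * N := by
    intro h
    have : p ≤ t * N := Nat.le_of_dvd (by positivity) h
    omega
  -- the representative `b₀ ∈ [0, p)` of `σ b`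
  set b₁ : ℤ := σ * b with hb₁def
  have hb₀nn : 0 ≤ b₁ % p := Int.emod_nonneg _ hp0
  set b₀ : ℕ := (b₁ % p).toNat with hb₀def
  have hb₀Z : (b₀ : ℤ) = b₁ % p := Int.toNat_of_nonneg hb₀nn
  have hb₀lt : (b₀ : ℤ) < p := by rw [hb₀Z]; exact Int.emod_lt_of_pos _ (by exact_mod_cast hpP.pos)
  have hpb₀ : ¬ p ∣ b₀ := by
    intro h
    have hb00 : b₀ = 0 := Nat.eq_zero_of_dvd_of_lt h (by exact_mod_cast hb₀lt)
    have hpb₁ : (p : ℤ) ∣ b₁ := Int.dvd_of_emod_eq_zero (by rw [← hb₀Z, hb00]; rfl)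
    have hpb : (p : ℤ) ∣ b := by
      have : b = σ * b₁ := by rw [hb₁def, ← mul_assoc, hσsq, one_mul]
      rw [this]; exact Dvd.dvd.mul_left hpb₁ σ
    have hpd : (p : ℤ) ∣ d := by
      have : d = σ * p - (t : ℤ) * N * b * kk := by linarith [hkey]
      rw [this]
      exact dvd_sub (Dvd.intro_left σ rfl) (Dvd.dvd.mul_right (Dvd.dvd.mul_left hpb _) kk)
    have hu : IsUnit (p : ℤ) := hcop_b.isUnit_of_dvd' hpd hpb
    rcases Int.isUnit_iff.mp hu with h1 | h1
    · exact hpP.one_lt.ne' (by exact_mod_cast h1)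
    · have : (0 : ℤ) ≤ p := by positivity
      omega
  -- the loop `{∞, t b₀/p} − {∞, b₀/p}` is `D`
  have hrat : ((b : ℚ)) / ((σ : ℚ) * p) = ((b₁ : ℚ)) / p := by
    rw [div_eq_div_iff (mul_ne_zero (by exact_mod_cast hσ0) hp0Q) hp0Q, hb₁def]
    have e := congrArg (fun z : ℤ => (z : ℚ)) hσsq
    push_cast at e ⊢
    linear_combination (-(b : ℚ) * p) * e
  have hms1 : modularSymbol f ((b₀ : ℚ) / p) = modularSymbol f ((b₁ : ℚ) / p) := by
    refine modularSymbol_eq_of_eq_add_int f (n := -(b₁ / p)) ?_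
    have e : ((b₀ : ℤ) : ℚ) = ((b₁ % p : ℤ) : ℚ) := by exact_mod_cast hb₀Z
    rw [Int.emod_def] at e
    push_cast at e ⊢
    rw [e]
    field_simp
    ring
  have hms2 : modularSymbol f (((t * b₀ : ℕ) : ℚ) / p) = modularSymbol f ((t : ℚ) * b₁ / p) := by
    refine modularSymbol_eq_of_eq_add_int f (n := -(t * (b₁ / p))) ?_
    have e : ((b₀ : ℤ) : ℚ) = ((b₁ % p : ℤ) : ℚ) := by exact_mod_cast hb₀Z
    rw [Int.emod_def] at e
    push_cast at e ⊢
    rw [e]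
    field_simp
    ring
  have hDloop : modularSymbol f (((t * b₀ : ℕ) : ℚ) / p) - modularSymbol f ((b₀ : ℚ) / p) = D := by
    rw [hms1, hms2, hDdef, ← hloop, mul_div_assoc, mul_div_assoc, ← hrat]
  have hDS : D ∈ degeneracyLoopsClassTwo f t :=
    ⟨p, b₀, hpP, hp3, hptN, hpb₀, hDloop.symm⟩
  -- conclusion
  intro x hx
  obtain ⟨j, hj⟩ := exists_add_conj_eq_int_mul f hre hx
  refine ⟨((j * k : ℤ) : ℂ) * D, ?_, k.natAbs ^ 2, ?_, ?_⟩
  · rw [← zsmul_eq_mul]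
    exact AddSubgroup.zsmul_mem _ (AddSubgroup.subset_closure hDS) _
  · intro h
    exact hk3 (Int.natCast_dvd.mpr (Nat.prime_three.dvd_of_dvd_pow h))
  · have hk2 : ((k.natAbs ^ 2 : ℕ) : ℂ) = (k : ℂ) ^ 2 := by
      have h' : (((k.natAbs : ℤ) ^ 2 : ℤ) : ℂ) = ((k ^ 2 : ℤ) : ℂ) :=
        congrArg (fun z : ℤ => (z : ℂ)) (Int.natAbs_sq k)
      push_cast at h'
      rw [Nat.cast_pow]
      simpa using h'
    have hx' : x + starRingEnd ℂ x = (j : ℂ) * (plusPeriod f : ℂ) := hj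
    rw [hk2, hx', map_mul, map_intCast, ← mul_add, hk]
    push_cast
    ring

/-- **THEOREM O′ (converse, es g22; PROVED).**  Every prime-class degeneracy loop IS a conjugation defect
(`Γ₀(tN)` is transitive on the cusps prime to `tN`), so the plus hypothesis forces a defect with plus
coordinate prime to `3`. -/
theorem conjDefect_of_degeneracyClass (hf : IsNewform0 f) (hQ : coeffField f = ⊥) {t : ℕ}
    (hd : DegeneracyClassPlusIndexPrimeTo f 3 t) :
    ∃ (a b c d : ℤ) (hdet : a * d - b * (t * c) = 1) (hc : (N : ℤ) ∣ c) (k : ℤ), ¬ 3 ∣ k ∧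
      conjDefect f t a b c d hdet hc + conj (conjDefect f t a b c d hdet hc) = (k : ℂ) * (plusPeriod f : ℂ) := by
  have hΩpos : 0 < plusPeriod f := IsNewform0.plusPeriod_pos_holds hf hQ
  have hΩ : plusPeriod f ≠ 0 := hΩpos.ne'
  have hΩC : (plusPeriod f : ℂ) ≠ 0 := by exact_mod_cast hΩ
  obtain ⟨hre, -⟩ := realPeriods_eq_zmultiples_of_plusPeriod_ne_zero f hΩ
  set S : Set ℂ := degeneracyLoopsClassTwo f t with hSdef
  have hSΛ : ∀ g ∈ S, g ∈ periodLattice f := fun g hg => degeneracyLoopsClassTwo_subset f t hg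
  have hgen : ∃ g ∈ S, ∃ j : ℤ, ¬ (3 : ℤ) ∣ j ∧ g + conj g = (j : ℂ) * (plusPeriod f : ℂ) := by
    by_contra hcon
    push Not at hcon
    have hS : ∀ g ∈ S, ∃ k : ℤ, g + conj g = 3 * (k : ℂ) * (plusPeriod f : ℂ) := by
      intro g hg
      obtain ⟨j, hj⟩ := exists_add_conj_eq_int_mul f hre (hSΛ g hg)
      have h3j : (3 : ℤ) ∣ j := by
        by_contra h3
        exact hcon g hg j h3 hj
      obtain ⟨k, rfl⟩ := h3j
      exact ⟨k, by rw [hj]; push_cast; ring⟩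
    obtain ⟨x₀, hx₀, hx₀tr⟩ := exists_mem_add_conj_eq f hre
    obtain ⟨y, hy, k, hk3, hky⟩ := hd x₀ hx₀
    obtain ⟨k', hk'⟩ := add_conj_mem_three_of_closure hS hy
    have hx₀tr' : x₀ + starRingEnd ℂ x₀ = (plusPeriod f : ℂ) := hx₀tr
    have hk'' : y + starRingEnd ℂ y = 3 * (k' : ℂ) * (plusPeriod f : ℂ) := hk'
    rw [hx₀tr', hk''] at hky
    have hkk : (k : ℂ) = 3 * (k' : ℂ) := mul_right_cancel₀ hΩC hky
    have hkz : (k : ℤ) = 3 * k' := by exact_mod_cast hkk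
    exact hk3 (Int.natCast_dvd_natCast.mp ⟨k', hkz⟩)
  obtain ⟨g, hg, j, hj3, hgj⟩ := hgen
  obtain ⟨m, b₀, hmp, -, hmtN, hmb, rfl⟩ := hg
  -- Bezout: `u m + v (b₀ t N) = 1`
  have hcopN : Nat.Coprime m (b₀ * (t * N)) :=
    Nat.Coprime.mul_right ((Nat.Prime.coprime_iff_not_dvd hmp).mpr hmb)
      ((Nat.Prime.coprime_iff_not_dvd hmp).mpr hmtN)
  have hcopZ : IsCoprime (m : ℤ) ((b₀ : ℤ) * (t * N)) := by
    have := Nat.Coprime.isCoprime hcopN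
    push_cast at this
    exact this
  obtain ⟨u, v, huv⟩ := hcopZ
  have hm0 : (m : ℤ) ≠ 0 := by exact_mod_cast hmp.ne_zero
  refine ⟨u, b₀, -(v * N), m, by linear_combination huv, ⟨-v, by ring⟩, j, hj3, ?_⟩
  rw [← loop_base_eq_conjDefect f t u b₀ (-(v * N)) m _ _ hm0]
  push_cast at hgj ⊢
  exact hgj

end Main

section Packaging

variable [NeZero N]

/-- **Unit conjugation defect of ratio `t`**: some `γ = (a b; tc d) ∈ Γ₀(tN)` whose defect
`D(γ) = {∞, δ∞}_f − {∞, γ∞}_f` (`δ = (a tb; c d) = diag(t,1) γ diag(t,1)⁻¹ ∈ Γ₀(N)`) has plus coordinate prime to `3` —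
i.e. the plus-period homomorphism `j_f : Γ₀(N) → ℤ → ℤ/3` is NOT invariant under `diag(t,1)`-conjugation on `Γ₀(tN)`
(`π₁^* j̄_f ≠ π_t^* j̄_f` in `Hom(Γ₀(tN), 𝔽₃)`). -/
def ConjDefectUnit (t : ℕ) : Prop :=
  ∃ (a b c d : ℤ) (hdet : a * d - b * (t * c) = 1) (hc : (N : ℤ) ∣ c) (k : ℤ), ¬ 3 ∣ k ∧
    conjDefect f t a b c d hdet hc + conj (conjDefect f t a b c d hdet hc) = (k : ℂ) * (plusPeriod f : ℂ)

/-- **ORBIT CRITERION (es g22; PROVED iff).**  For a rational newform and `3 ∣ t ≠ 0`: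
prime-class plus hypothesis of ratio `t` ⟺ a unit conjugation defect of ratio `t`. -/
theorem degeneracyClass_iff_conjDefectUnit (hf : IsNewform0 f) (hQ : coeffField f = ⊥) {t : ℕ}
    (ht0 : t ≠ 0) (ht3 : 3 ∣ t) :
    DegeneracyClassPlusIndexPrimeTo f 3 t ↔ ConjDefectUnit f t := by
  constructor
  · intro hd
    exact conjDefect_of_degeneracyClass f hf hQ hd
  · rintro ⟨a, b, c, d, hdet, hc, k, hk3, hk⟩
    exact degeneracyClass_of_conjDefect f hf hQ ht0 ht3 a b c d hdet hc ⟨k, hk3, hk⟩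

end Packaging

end Summit.BirchSwinnertonDyer.Rank1Residual.ManinAdditive.DegeneracyOrbit

end
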